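import Summits.ResolutionOfSingularities.ResolutionOfSingularities.Theorems.FrobeniusClosingSteerBetaLetterMonomial
import Summits.ResolutionOfSingularities.ResolutionOfSingularities.Theorems.FrobeniusClosingSteerBetaPolygonGauge
import Literature.AlgebraicGeometry.Resolution.CharPolyhedronSolvableVertex
import HarnessLib

/-!
# Crux `Steer` (stmt-ResolutionOfSingularities-16345), chain W4.1, β-LEAF, K-β2♭ part (II), file 1: the POLYGON WORDS
# `AlphaGe` / `BetaGe` / `BetaGt` / `𝔪^d` read on Cossart–Piltant's minimal exponent set `𝐒(f)` (def-free)

OURS (campaign `res-hironaka`, rung L ★L-G4, slot W4.1; statements about the route's own objects; they replace the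
role of no printed item and are NOT statements of the manuscript under review [claim: Hironaka2017, status:
under-review]; AI review is weaker than expert review). Seat res-D-pv-003 (gen 7), K-β2♭ kernel owner (res-L0-w41-plan-1
RULINGS 143/150 (2)/181b; res-L0-w41-idea-1 β-leaf v18.4 `PreparedTransferYHat` / `PreparedTransferXHat`).

The (II) transfer laws are proved INTRINSICALLY (no Cohen structure theorem): in a regular local ring with regular system
of parameters `t = (x, y, z, w)`, every `f` has Cossart–Piltant's finite antichain `𝐒(f) ⊂ ℕ⁴` of MINIMAL EXPONENTS
(`CossartPiltant.minExponents`, tree `Literature…CharPolyhedronSolvableVertex` / `…MonomialIdealsRegularParameters`, Prop. 2.1),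
and the threshold words of `…BetaPolygonWords` / `…BetaPolygonGauge` are memberships in MONOMIAL ideals of `t`, hence
conditions on `𝐒(f)`:

* `isRsopPart_four` — `(x, y, z, w)` with `(x,y,z,w) = 𝔪` in a four-dimensional regular local ring is a regular system of
  parameters (`IsRsopPart`).
* `mem_span_uPow_iff_forall_minExponents` — for an UP-CLOSED exponent set `B`: `f ∈ (t^b : b ∈ B) ⟺ 𝐒(f) ⊆ B`.
* `mem_pow_iff_forall_minExponents` — `f ∈ 𝔪^d ⟺ ∀ a ∈ 𝐒(f), d ≤ |a|`.
* `alphaGe_iff_forall_minExponents`, `betaGe_iff_forall_minExponents`, `betaGt_iff_forall_minExponents` — the words as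
  exponent conditions (slot `m = d − a₂ − a₃`; `x`-exponent `a₀`, `y`-exponent `a₁`).
* `exponent_eq_of_betaGe_of_not_betaGt` — an exponent satisfying the `BetaGe (α, β)` condition but not the `BetaGt (α, β)`
  condition is the VERTEX exponent `(αm, βm, i, j)` of its slot (both coordinates integral).

[cite: CossartPiltant2019, Prop. 2.1] [cite: CossartJannsenSaito2020, Def. 11.1] No Theses file is imported; nothing here is
a route item or a registration.
-/

noncomputable section

-- `Summit.<S>.<S>.…` duplicates the summit name by design (single-problem summit).
set_option linter.dupNamespace false

namespace Summit.ResolutionOfSingularities.ResolutionOfSingularities.Theorems.SwitchingDichotomy.BetaNewton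

open IsLocalRing
open Literature.AlgebraicGeometry.Resolution
open Literature.AlgebraicGeometry.Resolution.CossartPiltant (uPow uPow_mem_span_uPow uPow_mem_span_uPow_of_le minExponents)
open Summit.ResolutionOfSingularities.ResolutionOfSingularities.Theorems.SwitchingDichotomy.BetaPolygon
open Summit.ResolutionOfSingularities.ResolutionOfSingularities.Theorems.SwitchingDichotomy.BetaLetter
  (uPow_four monomial_eq_uPow range_four threshold_le_span_uPow monomial_mem_pow_of_le span_four_pow_eq_span_uPow
    alpha_le_threshold beta_le_threshold ceil_mul_mono floor_mul_mono)

variable {S : Type} [CommRing S]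

/-! ## §1 The regular system of parameters `(x, y, z, w)` and the engine `𝐒(f) ⊆ B` -/

/-- In a four-dimensional regular local ring, generators `x, y, z, w` of `𝔪` form a regular system of parameters.
[cite: Matsumura1987, Thm. 14.2] -/
theorem isRsopPart_four [IsLocalRing S] (hreg : IsRegularLocalRing S) (hdim : ringKrullDim S = 4) {x y z w : S}
    (hspan : Ideal.span {x, y, z, w} = maximalIdeal S) : IsRsopPart ![x, y, z, w] := by
  refine ⟨hreg, 0, Fin.elim0, by simpa using hdim, ?_⟩
  rw [Set.range_eq_empty Fin.elim0, Set.union_empty, range_four, hspan]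

/-- **`f ∈ (t^b : b ∈ B) ⟺ 𝐒(f) ⊆ B`** for an up-closed exponent set `B` and (part of) a regular system of parameters
`t` (Cossart–Piltant Prop. 2.1: `𝐒(f)` generates the least monomial ideal containing `f`). [cite: CossartPiltant2019, Prop. 2.1] -/
theorem mem_span_uPow_iff_forall_minExponents [IsLocalRing S] {n : ℕ} {t : Fin n → S} (ht : IsRsopPart t)
    {B : Set (Fin n → ℕ)} (hB : ∀ ⦃b c : Fin n → ℕ⦄, b ∈ B → b ≤ c → c ∈ B) (f : S) :
    f ∈ Ideal.span (uPow t '' B) ↔ ∀ a ∈ minExponents t f, a ∈ B := by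
  obtain ⟨-, hfA, hmin⟩ := ht.minExponents_spec f
  refine ⟨fun h a ha => ?_, fun h => ?_⟩
  · obtain ⟨b, hb, hba⟩ := hmin B h a ha
    exact hB hb hba
  · refine Ideal.span_mono ?_ hfA
    rintro _ ⟨a, ha, rfl⟩
    exact ⟨a, h a (Finset.mem_coe.mp ha), rfl⟩

/-- One direction without up-closedness: `f ∈ (t^b : b ∈ B)` as soon as every `a ∈ 𝐒(f)` has `t^a ∈ (t^b : b ∈ B)`-shape
membership in an ideal `I ⊇ (t^a : a ∈ 𝐒(f))`. [cite: CossartPiltant2019, Prop. 2.1] -/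
theorem mem_of_forall_minExponents_uPow_mem [IsLocalRing S] {n : ℕ} {t : Fin n → S} (ht : IsRsopPart t)
    {I : Ideal S} {f : S} (h : ∀ a ∈ minExponents t f, uPow t a ∈ I) : f ∈ I := by
  obtain ⟨-, hfA, -⟩ := ht.minExponents_spec f
  refine (Ideal.span_le.mpr ?_) hfA
  rintro _ ⟨a, ha, rfl⟩
  exact h a (Finset.mem_coe.mp ha)

/-- If `f` lies in a monomial ideal `(t^b : b ∈ B)`, every minimal exponent of `f` lies above some `b ∈ B`.
[cite: CossartPiltant2019, Prop. 2.1] -/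
theorem exists_le_of_mem_span_uPow [IsLocalRing S] {n : ℕ} {t : Fin n → S} (ht : IsRsopPart t)
    {B : Set (Fin n → ℕ)} {f : S} (h : f ∈ Ideal.span (uPow t '' B)) {a : Fin n → ℕ}
    (ha : a ∈ minExponents t f) : ∃ b ∈ B, b ≤ a :=
  (ht.minExponents_spec f).2.2 B h a ha

/-! ## §2 `𝔪^d` -/

/-- The total degree `|a| = a₀ + a₁ + a₂ + a₃` of an exponent of `![x, y, z, w]`. [folklore] -/
theorem sum_four (a : Fin 4 → ℕ) : ∑ l, a l = a 0 + a 1 + a 2 + a 3 := by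
  simp [Fin.sum_univ_four]

/-- **`f ∈ 𝔪^d ⟺ every minimal exponent has total degree `≥ d`.** [cite: CossartPiltant2019, Prop. 2.1] -/
theorem mem_pow_iff_forall_minExponents [IsLocalRing S] {x y z w : S} (ht : IsRsopPart ![x, y, z, w])
    (hspan : Ideal.span {x, y, z, w} = maximalIdeal S) (d : ℕ) (f : S) :
    f ∈ maximalIdeal S ^ d ↔ ∀ a ∈ minExponents ![x, y, z, w] f, d ≤ ∑ l, a l := by
  rw [← hspan, span_four_pow_eq_span_uPow]
  exact mem_span_uPow_iff_forall_minExponents ht (fun b c hb hbc => le_trans hb (Finset.sum_le_sum fun l _ => hbc l)) f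

/-! ## §3 The words `AlphaGe`, `BetaGe`, `BetaGt` as exponent conditions -/

section Words

variable (x y z w : S) (d : ℕ)

/-- The monomials of the `α`-condition lie in the `AlphaGe` ideal. [folklore] -/
theorem uPow_mem_alphaIdeal (ρ : ℚ) {c : Fin 4 → ℕ}
    (hc : d ≤ c 2 + c 3 ∨ ⌈ρ * ((d - c 2 - c 3 : ℕ) : ℚ)⌉₊ ≤ c 0) :
    uPow ![x, y, z, w] c ∈ Ideal.span {z, w} ^ d ⊔
      ⨆ (i : ℕ) (j : ℕ) (_ : i + j < d), Ideal.span {x ^ ⌈ρ * ((d - i - j : ℕ) : ℚ)⌉₊ * z ^ i * w ^ j} := by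
  rw [uPow_four]
  by_cases hzw : d ≤ c 2 + c 3
  · exact Ideal.mem_sup_left (monomial_mem_pow_of_le x y z w hzw)
  · have hc' : ⌈ρ * ((d - c 2 - c 3 : ℕ) : ℚ)⌉₊ ≤ c 0 := hc.resolve_left hzw
    push Not at hzw
    refine Ideal.mem_sup_right (Submodule.mem_iSup_of_mem (c 2) (Submodule.mem_iSup_of_mem (c 3)
      (Submodule.mem_iSup_of_mem hzw (Ideal.mem_span_singleton.mpr ?_))))
    refine ⟨x ^ (c 0 - ⌈ρ * ((d - c 2 - c 3 : ℕ) : ℚ)⌉₊) * y ^ c 1, ?_⟩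
    rw [show x ^ c 0 = x ^ ⌈ρ * ((d - c 2 - c 3 : ℕ) : ℚ)⌉₊ * x ^ (c 0 - ⌈ρ * ((d - c 2 - c 3 : ℕ) : ℚ)⌉₊) by
      rw [← pow_add, Nat.add_sub_cancel' hc']]
    ring

/-- The monomials of the `β`-condition lie in the `BetaGe` ideal. [folklore] -/
theorem uPow_mem_betaIdeal (α ρ : ℚ) {c : Fin 4 → ℕ}
    (hc : d ≤ c 2 + c 3 ∨ ⌊α * ((d - c 2 - c 3 : ℕ) : ℚ)⌋₊ + 1 ≤ c 0 ∨
      (⌈α * ((d - c 2 - c 3 : ℕ) : ℚ)⌉₊ ≤ c 0 ∧ ⌈ρ * ((d - c 2 - c 3 : ℕ) : ℚ)⌉₊ ≤ c 1)) :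
    uPow ![x, y, z, w] c ∈ Ideal.span {z, w} ^ d ⊔
      ⨆ (i : ℕ) (j : ℕ) (_ : i + j < d),
        (Ideal.span {x ^ (⌊α * ((d - i - j : ℕ) : ℚ)⌋₊ + 1) * z ^ i * w ^ j} ⊔
          Ideal.span {x ^ ⌈α * ((d - i - j : ℕ) : ℚ)⌉₊ * y ^ ⌈ρ * ((d - i - j : ℕ) : ℚ)⌉₊ * z ^ i * w ^ j}) := by
  rw [uPow_four]
  by_cases hzw : d ≤ c 2 + c 3
  · exact Ideal.mem_sup_left (monomial_mem_pow_of_le x y z w hzw)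
  · push Not at hzw
    refine Ideal.mem_sup_right (Submodule.mem_iSup_of_mem (c 2) (Submodule.mem_iSup_of_mem (c 3)
      (Submodule.mem_iSup_of_mem hzw ?_)))
    set n : ℕ := d - c 2 - c 3 with hn
    rcases hc with hc | hc | ⟨hca, hcb⟩
    · exact absurd hc (not_le.mpr hzw)
    · refine Ideal.mem_sup_left (Ideal.mem_span_singleton.mpr ⟨x ^ (c 0 - (⌊α * (n : ℚ)⌋₊ + 1)) * y ^ c 1, ?_⟩)
      rw [show x ^ c 0 = x ^ (⌊α * (n : ℚ)⌋₊ + 1) * x ^ (c 0 - (⌊α * (n : ℚ)⌋₊ + 1)) by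
        rw [← pow_add, Nat.add_sub_cancel' hc]]
      ring
    · refine Ideal.mem_sup_right (Ideal.mem_span_singleton.mpr
        ⟨x ^ (c 0 - ⌈α * (n : ℚ)⌉₊) * y ^ (c 1 - ⌈ρ * (n : ℚ)⌉₊), ?_⟩)
      rw [show x ^ c 0 = x ^ ⌈α * (n : ℚ)⌉₊ * x ^ (c 0 - ⌈α * (n : ℚ)⌉₊) by
        rw [← pow_add, Nat.add_sub_cancel' hca],
        show y ^ c 1 = y ^ ⌈ρ * (n : ℚ)⌉₊ * y ^ (c 1 - ⌈ρ * (n : ℚ)⌉₊) by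
        rw [← pow_add, Nat.add_sub_cancel' hcb]]
      ring

/-- The monomials of the strict `β`-condition lie in the `BetaGt` ideal. [folklore] -/
theorem uPow_mem_betaGtIdeal (α β : ℚ) {c : Fin 4 → ℕ}
    (hc : d ≤ c 2 + c 3 ∨ ⌊α * ((d - c 2 - c 3 : ℕ) : ℚ)⌋₊ + 1 ≤ c 0 ∨
      (⌈α * ((d - c 2 - c 3 : ℕ) : ℚ)⌉₊ ≤ c 0 ∧ ⌊β * ((d - c 2 - c 3 : ℕ) : ℚ)⌋₊ + 1 ≤ c 1)) :
    uPow ![x, y, z, w] c ∈ Ideal.span {z, w} ^ d ⊔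
      ⨆ (i : ℕ) (j : ℕ) (_ : i + j < d),
        (Ideal.span {x ^ (⌊α * ((d - i - j : ℕ) : ℚ)⌋₊ + 1) * z ^ i * w ^ j} ⊔
          Ideal.span {x ^ ⌈α * ((d - i - j : ℕ) : ℚ)⌉₊ * y ^ (⌊β * ((d - i - j : ℕ) : ℚ)⌋₊ + 1) * z ^ i * w ^ j}) := by
  rw [uPow_four]
  by_cases hzw : d ≤ c 2 + c 3
  · exact Ideal.mem_sup_left (monomial_mem_pow_of_le x y z w hzw)
  · push Not at hzw
    refine Ideal.mem_sup_right (Submodule.mem_iSup_of_mem (c 2) (Submodule.mem_iSup_of_mem (c 3)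
      (Submodule.mem_iSup_of_mem hzw ?_)))
    set n : ℕ := d - c 2 - c 3 with hn
    rcases hc with hc | hc | ⟨hca, hcb⟩
    · exact absurd hc (not_le.mpr hzw)
    · refine Ideal.mem_sup_left (Ideal.mem_span_singleton.mpr ⟨x ^ (c 0 - (⌊α * (n : ℚ)⌋₊ + 1)) * y ^ c 1, ?_⟩)
      rw [show x ^ c 0 = x ^ (⌊α * (n : ℚ)⌋₊ + 1) * x ^ (c 0 - (⌊α * (n : ℚ)⌋₊ + 1)) by
        rw [← pow_add, Nat.add_sub_cancel' hc]]
      ring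
    · refine Ideal.mem_sup_right (Ideal.mem_span_singleton.mpr
        ⟨x ^ (c 0 - ⌈α * (n : ℚ)⌉₊) * y ^ (c 1 - (⌊β * (n : ℚ)⌋₊ + 1)), ?_⟩)
      rw [show x ^ c 0 = x ^ ⌈α * (n : ℚ)⌉₊ * x ^ (c 0 - ⌈α * (n : ℚ)⌉₊) by
        rw [← pow_add, Nat.add_sub_cancel' hca],
        show y ^ c 1 = y ^ (⌊β * (n : ℚ)⌋₊ + 1) * y ^ (c 1 - (⌊β * (n : ℚ)⌋₊ + 1)) by
        rw [← pow_add, Nat.add_sub_cancel' hcb]]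
      ring

/-- Embedding of the strict `β`-threshold word shape (`BetaGt`) into the slot-condition shape. [folklore] -/
theorem betaGt_le_threshold (α β : ℚ) :
    (Ideal.span {z, w} ^ d ⊔ ⨆ (i : ℕ) (j : ℕ) (_ : i + j < d),
      (Ideal.span {x ^ (⌊α * ((d - i - j : ℕ) : ℚ)⌋₊ + 1) * z ^ i * w ^ j} ⊔
        Ideal.span {x ^ ⌈α * ((d - i - j : ℕ) : ℚ)⌉₊ * y ^ (⌊β * ((d - i - j : ℕ) : ℚ)⌋₊ + 1) * z ^ i * w ^ j})) ≤
    Ideal.span {z, w} ^ d ⊔ ⨆ (i : ℕ) (j : ℕ) (_ : i + j < d) (a : ℕ) (b : ℕ)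
      (_ : ⌊α * ((d - i - j : ℕ) : ℚ)⌋₊ + 1 ≤ a ∨
        (⌈α * ((d - i - j : ℕ) : ℚ)⌉₊ ≤ a ∧ ⌊β * ((d - i - j : ℕ) : ℚ)⌋₊ + 1 ≤ b)),
      Ideal.span {x ^ a * y ^ b * z ^ i * w ^ j} := by
  refine sup_le le_sup_left (iSup_le fun i => iSup_le fun j => iSup_le fun hij => sup_le ?_ ?_)
  · refine le_sup_right.trans' (le_iSup_of_le i (le_iSup_of_le j (le_iSup_of_le hij
      (le_iSup_of_le _ (le_iSup_of_le 0 (le_iSup_of_le (Or.inl le_rfl) ?_))))))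
    exact Ideal.span_singleton_le_span_singleton.mpr ⟨1, by ring⟩
  · refine le_sup_right.trans' (le_iSup_of_le i (le_iSup_of_le j (le_iSup_of_le hij
      (le_iSup_of_le _ (le_iSup_of_le _ (le_iSup_of_le (Or.inr ⟨le_rfl, le_rfl⟩) le_rfl))))))

variable {x y z w d}

/-- **`AlphaGe` on `𝐒(f)`**: `α(f) ≥ ρ` (`ρ ≥ 0`) iff every minimal exponent `a` has `a₂ + a₃ ≥ d` or
`a₀ ≥ ⌈ρ (d − a₂ − a₃)⌉`. [cite: CossartPiltant2019, Prop. 2.1] [cite: CossartJannsenSaito2020, Def. 11.1] -/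
theorem alphaGe_iff_forall_minExponents [IsLocalRing S] (ht : IsRsopPart ![x, y, z, w]) {ρ : ℚ} (hρ : 0 ≤ ρ)
    (f : S) : AlphaGe x z w d ρ f ↔ ∀ a ∈ minExponents ![x, y, z, w] f,
      d ≤ a 2 + a 3 ∨ ⌈ρ * ((d - a 2 - a 3 : ℕ) : ℚ)⌉₊ ≤ a 0 := by
  refine ⟨fun h a ha => ?_, fun h => mem_of_forall_minExponents_uPow_mem ht fun a ha =>
    uPow_mem_alphaIdeal x y z w d ρ (h a ha)⟩
  have h' := threshold_le_span_uPow x y z w d (fun n a _ => ⌈ρ * (n : ℚ)⌉₊ ≤ a)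
    (alpha_le_threshold x y z w d ρ h)
  obtain ⟨b, hb, hba⟩ := exists_le_of_mem_span_uPow ht h' ha
  rcases hb with hb | ⟨-, hb⟩
  · exact Or.inl (hb.trans (Nat.add_le_add (hba 2) (hba 3)))
  · by_cases hzw : d ≤ a 2 + a 3
    · exact Or.inl hzw
    · refine Or.inr ((ceil_mul_mono hρ ?_).trans (hb.trans (hba 0)))
      have h2 : b 2 ≤ a 2 := hba 2; have h3 : b 3 ≤ a 3 := hba 3
      omega

/-- **`BetaGe` on `𝐒(f)`**: `β(f) ≥ ρ` on the column `a = α` (`α, ρ ≥ 0`) iff every minimal exponent is in `(z,w)^d`, or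
STRICTLY right of the column (`a₀ ≥ ⌊α m⌋ + 1`), or on-or-right of it and not below `ρ` (`a₀ ≥ ⌈α m⌉ ∧ a₁ ≥ ⌈ρ m⌉`).
[cite: CossartPiltant2019, Prop. 2.1] [cite: CossartJannsenSaito2020, Def. 11.1] -/
theorem betaGe_iff_forall_minExponents [IsLocalRing S] (ht : IsRsopPart ![x, y, z, w]) {α ρ : ℚ} (hα : 0 ≤ α)
    (hρ : 0 ≤ ρ) (f : S) : BetaGe x y z w d α ρ f ↔ ∀ a ∈ minExponents ![x, y, z, w] f,
      d ≤ a 2 + a 3 ∨ ⌊α * ((d - a 2 - a 3 : ℕ) : ℚ)⌋₊ + 1 ≤ a 0 ∨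
        (⌈α * ((d - a 2 - a 3 : ℕ) : ℚ)⌉₊ ≤ a 0 ∧ ⌈ρ * ((d - a 2 - a 3 : ℕ) : ℚ)⌉₊ ≤ a 1) := by
  refine ⟨fun h a ha => ?_, fun h => mem_of_forall_minExponents_uPow_mem ht fun a ha =>
    uPow_mem_betaIdeal x y z w d α ρ (h a ha)⟩
  have h' := threshold_le_span_uPow x y z w d
    (fun n a b => ⌊α * (n : ℚ)⌋₊ + 1 ≤ a ∨ (⌈α * (n : ℚ)⌉₊ ≤ a ∧ ⌈ρ * (n : ℚ)⌉₊ ≤ b))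
    (beta_le_threshold x y z w d α ρ h)
  obtain ⟨b, hb, hba⟩ := exists_le_of_mem_span_uPow ht h' ha
  by_cases hzw : d ≤ a 2 + a 3
  · exact Or.inl hzw
  · right
    rcases hb with hb | ⟨-, hb⟩
    · exact absurd (hb.trans (Nat.add_le_add (hba 2) (hba 3))) hzw
    · have hmn : d - a 2 - a 3 ≤ d - b 2 - b 3 := by
        have h2 : b 2 ≤ a 2 := hba 2; have h3 : b 3 ≤ a 3 := hba 3; omega
      rcases hb with hb | ⟨hb0, hb1⟩
      · exact Or.inl (le_trans (Nat.add_le_add_right (floor_mul_mono hα hmn) 1) (hb.trans (hba 0)))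
      · exact Or.inr ⟨(ceil_mul_mono hα hmn).trans (hb0.trans (hba 0)),
          (ceil_mul_mono hρ hmn).trans (hb1.trans (hba 1))⟩

/-- **`BetaGt` on `𝐒(f)`**: the left vertex is lexicographically BEYOND `(α, β)` (`α, β ≥ 0`) iff every minimal exponent is
in `(z,w)^d`, or strictly right of the column, or on-or-right of it and STRICTLY above `β` (`a₁ ≥ ⌊β m⌋ + 1`).
[cite: CossartPiltant2019, Prop. 2.1] -/
theorem betaGt_iff_forall_minExponents [IsLocalRing S] (ht : IsRsopPart ![x, y, z, w]) {α β : ℚ} (hα : 0 ≤ α)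
    (hβ : 0 ≤ β) (f : S) : BetaGt x y z w d α β f ↔ ∀ a ∈ minExponents ![x, y, z, w] f,
      d ≤ a 2 + a 3 ∨ ⌊α * ((d - a 2 - a 3 : ℕ) : ℚ)⌋₊ + 1 ≤ a 0 ∨
        (⌈α * ((d - a 2 - a 3 : ℕ) : ℚ)⌉₊ ≤ a 0 ∧ ⌊β * ((d - a 2 - a 3 : ℕ) : ℚ)⌋₊ + 1 ≤ a 1) := by
  refine ⟨fun h a ha => ?_, fun h => mem_of_forall_minExponents_uPow_mem ht fun a ha =>
    uPow_mem_betaGtIdeal x y z w d α β (h a ha)⟩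
  have h' := threshold_le_span_uPow x y z w d
    (fun n a b => ⌊α * (n : ℚ)⌋₊ + 1 ≤ a ∨ (⌈α * (n : ℚ)⌉₊ ≤ a ∧ ⌊β * (n : ℚ)⌋₊ + 1 ≤ b))
    (betaGt_le_threshold x y z w d α β h)
  obtain ⟨b, hb, hba⟩ := exists_le_of_mem_span_uPow ht h' ha
  by_cases hzw : d ≤ a 2 + a 3
  · exact Or.inl hzw
  · right
    rcases hb with hb | ⟨-, hb⟩
    · exact absurd (hb.trans (Nat.add_le_add (hba 2) (hba 3))) hzw
    · have hmn : d - a 2 - a 3 ≤ d - b 2 - b 3 := by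
        have h2 : b 2 ≤ a 2 := hba 2; have h3 : b 3 ≤ a 3 := hba 3; omega
      rcases hb with hb | ⟨hb0, hb1⟩
      · exact Or.inl (le_trans (Nat.add_le_add_right (floor_mul_mono hα hmn) 1) (hb.trans (hba 0)))
      · exact Or.inr ⟨(ceil_mul_mono hα hmn).trans (hb0.trans (hba 0)),
          le_trans (Nat.add_le_add_right (floor_mul_mono hβ hmn) 1) (hb1.trans (hba 1))⟩

end Words

/-! ## §4 Vertex exponents -/

/-- **An exponent on-or-beyond `(α, β)` but not strictly beyond it is the VERTEX exponent of its slot**: `a₂ + a₃ < d`,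
`a₀ = α m` and `a₁ = β m` with `m = d − a₂ − a₃` (in particular `α m, β m ∈ ℕ`). [folklore] -/
theorem exponent_eq_of_betaGe_of_not_betaGt {d : ℕ} {α β : ℚ} (hα : 0 ≤ α) (hβ : 0 ≤ β) {a : Fin 4 → ℕ}
    (hG : d ≤ a 2 + a 3 ∨ ⌊α * ((d - a 2 - a 3 : ℕ) : ℚ)⌋₊ + 1 ≤ a 0 ∨
      (⌈α * ((d - a 2 - a 3 : ℕ) : ℚ)⌉₊ ≤ a 0 ∧ ⌈β * ((d - a 2 - a 3 : ℕ) : ℚ)⌉₊ ≤ a 1))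
    (hI : ¬ (d ≤ a 2 + a 3 ∨ ⌊α * ((d - a 2 - a 3 : ℕ) : ℚ)⌋₊ + 1 ≤ a 0 ∨
      (⌈α * ((d - a 2 - a 3 : ℕ) : ℚ)⌉₊ ≤ a 0 ∧ ⌊β * ((d - a 2 - a 3 : ℕ) : ℚ)⌋₊ + 1 ≤ a 1))) :
    a 2 + a 3 < d ∧ ((a 0 : ℚ) = α * ((d - a 2 - a 3 : ℕ) : ℚ)) ∧ ((a 1 : ℚ) = β * ((d - a 2 - a 3 : ℕ) : ℚ)) := by
  push Not at hI
  obtain ⟨hzw, hfl, himp⟩ := hI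
  rcases hG with hG | hG | ⟨hG0, hG1⟩
  · exact absurd hG (not_le.mpr hzw)
  · exact absurd hG (not_le.mpr hfl)
  have hb := himp hG0
  set n : ℕ := d - a 2 - a 3 with hn
  have hαn : 0 ≤ α * (n : ℚ) := mul_nonneg hα (Nat.cast_nonneg n)
  have hβn : 0 ≤ β * (n : ℚ) := mul_nonneg hβ (Nat.cast_nonneg n)
  refine ⟨hzw, ?_, ?_⟩
  · -- `⌈α n⌉ ≤ a₀ ≤ ⌊α n⌋`
    have h1 : a 0 ≤ ⌊α * (n : ℚ)⌋₊ := Nat.lt_succ_iff.mp hfl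
    exact le_antisymm ((Nat.cast_le.mpr h1).trans (Nat.floor_le hαn)) (Nat.ceil_le.mp hG0)
  · have h1 : a 1 ≤ ⌊β * (n : ℚ)⌋₊ := Nat.lt_succ_iff.mp hb
    exact le_antisymm ((Nat.cast_le.mpr h1).trans (Nat.floor_le hβn)) (Nat.ceil_le.mp hG1)

end Summit.ResolutionOfSingularities.ResolutionOfSingularities.Theorems.SwitchingDichotomy.BetaNewton

end
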